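import Summits.QuantumFields.YangMills.Theorems.BalabanUVNodesN21ExpWindowHaarMassLtOne
import Summits.QuantumFields.BalabanUV.T4Continuum.Support.ShellMeasureAxialReachSUN

/-!
# N21 (NE7c) · THE WINDOW-LETTER ALGEBRA of the chart road's per-fibre factorisation `hlaw : μ = (blockLaw b).withDensity (windowSU b c S · R)`:
# SUPPORT FORM (a density vanishing off the product window `∏ c(i)·exp B̄_S` IS window-factorised, with `R :=` itself), its COMB-GAUGE instance from
# PLAQUETTE SMALLNESS by pub-balaban's reach lemma, and RADIUS MONOTONICITY — the shapes in which junction №5's located letter is to be supplied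

Width seat pub-ymgap-dag-n21-w1 (g3; director-ym №197 ∕ HUMAN RULING D-0149), node N21 = NE7c (NOT PRINTED in [Bałaban 1983–89], NOT proved), lane K3⁷
`SpineGivenEndpointR13SepCoPH` (stmt-QuantumFields-20544, `--kind proof --supports … --as helper`).  File 22 of the seat's chain (offer (α) of the ASK-NEXT line,
bus 2026-08-28 ≈10:00Z).  THEOREMS ONLY: 0 `def`, 0 `sorry`; count-neutral.  Imports file 18 `…N21ExpWindowHaarMassLtOne` (p618437; `expBallSU_mono`; brings pub-balaban's
`ShellMeasureScalingSUN`: `expWindowSU`, `windowSU`, `blockLaw`) and pub-balaban's `Support.ShellMeasureAxialReachSUN` (`windowSU_eq_one_of_mem`, `mem_expWindowSU_of_comb`).  NO Theses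
import.  Restates nothing; composes BY NAME.

WHY.  Junctions №3 (p605800) ∕ №5 (p617179, dag-n21-w2) ask per exterior field the WINDOW FACTORISATION `hlaw` of a block fibre law `(∏_b Haar).withDensity G` — a LOCATED
letter (NODE O's term object: where the (gauge-fixed) dressed density lives).  This file records, once, the three elementary ways the letter is MET, so that a support
statement of any provenance plugs in BY NAME: (i) if `G` vanishes unless every block bond lies in its window `c(i)·exp B̄_S`, then `hlaw` holds with `R := G` (the window
weight is `1` on the support — pub-balaban's reach lemma is the level-0 instance of such a support statement, `ShellMeasureAxialReachSUN.mem_expWindowSU_of_comb`);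
(ii) a factorisation at radius `S` is one at every `S' ≥ S` (same centre, `R' := windowSU S · R`).  (By file 19 `…ExpChartSurjective.expWindowSU_eq_univ_of_le`, at
radius `S ≥ (N+1)·√N·π` the window is the whole group and the letter is free for EVERY density — it has content only together with the chart's constraint `S ≤ π`,
and, by file 21, only at blocks avoiding site stars unless the density is gauge-FIXED.)

WHAT IS PROVED ([folklore] pointwise identities of `ℝ≥0∞`-densities + `withDensity_congr`; every pub-balaban ∕ sibling module credited by name).
* §1 SUPPORT FORM: `windowSU_mul_eq_self_of_support`, ★ `withDensity_eq_window_mul_of_support` (any base measure), ★ `pi_withDensity_eq_blockLaw_window_mul_of_support`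
  (the literal `hlaw` shape of junction №5: `(∏_b Haar).withDensity G = (blockLaw b).withDensity (windowSU b c S · G)`).
* §1b ★★ `pi_withDensity_fixTo_comb_eq_blockLaw_window_mul` — junction №5's `hlaw` IN THE COMB GAUGE (`T := combBonds lo hi`, `U₀ := 1`, `c := 1`, `R :=` the
  gauge-fixed fibre density) PRODUCED from a support statement «the UNFIXED density `Gd` vanishes unless the box plaquettes are `a`-small» for every block of box bonds off
  the comb and every exterior field, by pub-balaban's reach `ShellMeasureAxialReachSUN.mem_expWindowSU_of_comb` BY NAME (reach conditions `N·((d−1)·n·a) < 4`,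
  `√N·(π∕2)·((d−1)·n·a) ≤ S` displayed).
* §2 RADIUS MONOTONICITY: `expWindowSU_mono`, `windowSU_mul_windowSU_of_le` (`S ≤ S' ⇒ windowSU S' · windowSU S = windowSU S`), ★ `hlaw_mono`
  (`μ = (blockLaw b).withDensity (windowSU S · R)`, `S ≤ S'` ⇒ `μ = (blockLaw b).withDensity (windowSU S' · (windowSU S · R))`).

HONEST FRAMING.  [folklore]; WHERE the (gauge-fixed) dressed density is supported — the support statement feeding §1 at a radius `S ≤ π` — is NOT typed here (NODE O's term
object ∕ located); nothing of Bałaban's asserted; (M1) ∕ NE7c NOT PRINTED ∕ NOT proved; **N21 NOT discharged**; K3⁷ NOT claimed; counts unmoved (typed 28∕28 · discharged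
5∕27); never a count claim; one finite 𝕋⁴ at fixed ε — R4 would close only the conditional finite-𝕋⁴ rung `BalabanLadder.UV`, NOT the Yang–Mills mass gap (Clay); nothing
about ℝ⁴ ∕ OS.  No decl below carries a cite tag.
-/

set_option autoImplicit false

noncomputable section

open scoped BigOperators ENNReal
open MeasureTheory Set Function Finset Metric

namespace Summit.QuantumFields.YangMills.Theorems.N21WindowLetterAlgebra

open Literature.MathematicalPhysics.QuantumFieldTheory.Balaban1983to89
open Literature.MathematicalPhysics.QuantumFieldTheory.Balaban1983to89.T4ShellMeasureDet (blockLaw blockLaw_eq_pi)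
open Summit.QuantumFields.BalabanUV.T4Continuum
open Summit.QuantumFields.BalabanUV.T4Continuum.ShellMeasureExpChartSUN (SUN)
open Summit.QuantumFields.BalabanUV.T4Continuum.ShellMeasureScalingSUN (expBallSU expWindowSU windowSU windowSU_eq_indicator)
open Summit.QuantumFields.BalabanUV.T4Continuum.ShellMeasureAxialReachSUN (windowSU_eq_one_of_mem)
open Summit.QuantumFields.YangMills.Theorems.N21ExpWindowHaarMassLtOne (expBallSU_mono)

variable {N : ℕ} {P : Params} {j : ℕ}

/-! ## §1 Support form: a density carried by the product window IS window-factorised, with `R :=` itself -/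

section Support

/-- on the support of a density carried by the product window the window weight is `1`, so `windowSU · G = G`. [folklore] -/
theorem windowSU_mul_eq_self_of_support (b : Finset (PBond P j)) (c : GaugeField P j (SUN N)) (S : ℝ) (G : (↥b → SUN N) → ℝ≥0∞)
    (hG : ∀ y, G y ≠ 0 → ∀ i : ↥b, y i ∈ expWindowSU (c i) S) :
    (fun y => windowSU b c S y * G y) = G := by
  funext y
  by_cases h : G y = 0
  · rw [h, mul_zero]
  · rw [windowSU_eq_one_of_mem b c S (hG y h), one_mul]

/-- ★ **SUPPORT ⇒ WINDOW FACTORISATION** (any base measure `μ₀` on the block configurations): `μ₀.withDensity G = μ₀.withDensity (windowSU b c S · G)`. [folklore] -/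
theorem withDensity_eq_window_mul_of_support (b : Finset (PBond P j)) (c : GaugeField P j (SUN N)) (S : ℝ) (μ₀ : Measure (↥b → SUN N))
    (G : (↥b → SUN N) → ℝ≥0∞) (hG : ∀ y, G y ≠ 0 → ∀ i : ↥b, y i ∈ expWindowSU (c i) S) :
    μ₀.withDensity G = μ₀.withDensity (fun y => windowSU b c S y * G y) := by
  rw [windowSU_mul_eq_self_of_support b c S G hG]

variable [NeZero N]

/-- ★ **THE LITERAL `hlaw` SHAPE OF JUNCTION №5 FROM A SUPPORT STATEMENT**: for a density `G` on `↥b → SU(N)` vanishing unless every block bond lies in its window,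
`(∏_b Haar).withDensity G = (blockLaw b).withDensity (fun y => windowSU b c S y * G y)` — i.e. `hlaw` with `R := G`. [folklore] -/
theorem pi_withDensity_eq_blockLaw_window_mul_of_support (b : Finset (PBond P j)) (c : GaugeField P j (SUN N)) (S : ℝ)
    (G : (↥b → SUN N) → ℝ≥0∞) (hG : ∀ y, G y ≠ 0 → ∀ i : ↥b, y i ∈ expWindowSU (c i) S) :
    (Measure.pi fun _ : ↥b => (HaarData.haar : Measure (SUN N))).withDensity G =
      (blockLaw b).withDensity (fun y => windowSU b c S y * G y) := by
  rw [blockLaw_eq_pi, windowSU_mul_eq_self_of_support b c S G hG]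

end Support

/-! ## §1b The support statement from PLAQUETTE SMALLNESS in the comb (tree) gauge — pub-balaban's reach lemma BY NAME -/

section Comb

open Literature.MathematicalPhysics.QuantumFieldTheory.Balaban1983to89.T4TreeGaugeFixing (fixTo fixTo_apply_of_not_mem)
open Literature.MathematicalPhysics.QuantumFieldTheory.Balaban1983to89.T4AxialGaugeFixing (combBonds)
open Literature.MathematicalPhysics.QuantumFieldTheory.Balaban1983to89.T4AxialGaugeSmallField (boxPlaqs boxBonds)
open Summit.QuantumFields.BalabanUV.T4Continuum.ShellMeasureAxialReachSUN (mem_expWindowSU_of_comb)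
open Summit.QuantumFields.BalabanUV.T4Continuum.ShellMeasureAxialReach (fixTo_comb_eq_one)

variable [NeZero N] [DecidableEq (PBond P j)]

/-- ★★ **THE WINDOW LETTER OF JUNCTION №5 IN THE COMB GAUGE, FROM A PLAQUETTE-SMALLNESS SUPPORT STATEMENT** (tree `T := combBonds lo hi`, reference `U₀ := 1`,
centre `c := 1`, `R :=` the gauge-fixed fibre density itself).  If a density `Gd` on the gauge fields VANISHES unless the box plaquettes are `a`-small (`S₀ ⊇ boxPlaqs lo hi`)
— a support statement about the UNFIXED density — then for every block `b` of box bonds OFF the comb and every exterior field `x`, the comb-gauge-fixed block fibre law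
factorises through the window of radius `S` about `1`: by pub-balaban's reach (`ShellMeasureAxialReachSUN.mem_expWindowSU_of_comb`: comb-trivial + `a`-small box plaquettes
⇒ every box bond in `exp B̄_S`, under the reach conditions `N·((d−1)·n·a) < 4`, `√N·(π∕2)·((d−1)·n·a) ≤ S`). [folklore] -/
theorem pi_withDensity_fixTo_comb_eq_blockLaw_window_mul {lo hi : Fin P.d → ℤ} {a S : ℝ} {S₀ : Set (Plaq P j)} {n : ℕ}
    (hS₀ : boxPlaqs lo hi ⊆ S₀) (ha : 0 ≤ a) (hn : ∀ κ, hi κ ≤ lo κ + n)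
    (hN4 : (N : ℝ) * (((P.d - 1 : ℕ) : ℝ) * n * a) < 4)
    (hrad : Real.sqrt N * (Real.pi / 2 * (((P.d - 1 : ℕ) : ℝ) * n * a)) ≤ S)
    (Gd : GaugeField P j (SUN N) → ℝ≥0∞) (hGd : ∀ V, Gd V ≠ 0 → PlaqSmallOn S₀ a V)
    (b : Finset (PBond P j)) (hbox : ∀ i ∈ b, i ∈ boxBonds lo hi) (hcomb : ∀ i ∈ b, i ∉ (combBonds lo hi : Finset (PBond P j)))
    (x : GaugeField P j (SUN N)) :
    (Measure.pi fun _ : ↥b => (HaarData.haar : Measure (SUN N))).withDensity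
        (fun y => Gd (fixTo (combBonds lo hi) 1 (Function.updateFinset x b y))) =
      (blockLaw b).withDensity (fun y => windowSU b (1 : GaugeField P j (SUN N)) S y *
        Gd (fixTo (combBonds lo hi) 1 (Function.updateFinset x b y))) := by
  refine pi_withDensity_eq_blockLaw_window_mul_of_support b 1 S _ fun y hy i => ?_
  -- the comb-fixed glued configuration has comb bonds `1` and `a`-small box plaquettes, so ALL its box bonds are in the window …
  have hW := mem_expWindowSU_of_comb (fixTo (combBonds lo hi) 1 (Function.updateFinset x b y)) hS₀ (hGd _ hy) ha hn
    (fixTo_comb_eq_one lo hi _) hN4 hrad (hbox i i.2)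
  -- … and on the block (off the comb) that configuration IS `y`
  rw [fixTo_apply_of_not_mem (hcomb i i.2)] at hW
  have hyi : Function.updateFinset x b y (i : PBond P j) = y i := by
    simp only [Function.updateFinset, dif_pos i.2]
  rw [hyi] at hW
  exact hW

end Comb

/-! ## §2 Radius monotonicity -/

section Mono

/-- the windows about a centre are monotone in the radius. [folklore] -/
theorem expWindowSU_mono (g : SUN N) {S S' : ℝ} (h : S ≤ S') : expWindowSU g S ⊆ expWindowSU g S' :=
  image_mono (expBallSU_mono h)

/-- `S ≤ S' ⇒ windowSU S' · windowSU S = windowSU S` (product of the indicators of nested product windows). [folklore] -/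
theorem windowSU_mul_windowSU_of_le (b : Finset (PBond P j)) (c : GaugeField P j (SUN N)) {S S' : ℝ} (h : S ≤ S') (y : ↥b → SUN N) :
    windowSU b c S' y * windowSU b c S y = windowSU b c S y := by
  rw [windowSU_eq_indicator b c S, windowSU_eq_indicator b c S']
  by_cases hy : y ∈ Set.pi univ fun i : ↥b => expWindowSU (c i) S
  · have hy' : y ∈ Set.pi univ fun i : ↥b => expWindowSU (c i) S' := fun i hi => expWindowSU_mono (c i) h (hy i hi)
    rw [indicator_of_mem hy, indicator_of_mem hy', Pi.one_apply, one_mul]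
  · rw [indicator_of_notMem hy, mul_zero]

/-- ★ **A WINDOW FACTORISATION AT RADIUS `S` IS ONE AT EVERY LARGER RADIUS** (same centre, weight `windowSU S · R`). [folklore] -/
theorem hlaw_mono (b : Finset (PBond P j)) (c : GaugeField P j (SUN N)) {S S' : ℝ} (h : S ≤ S') [NeZero N]
    {μ : Measure (↥b → SUN N)} {R : (↥b → SUN N) → ℝ≥0∞}
    (hlaw : μ = (blockLaw b).withDensity fun y => windowSU b c S y * R y) :
    μ = (blockLaw b).withDensity fun y => windowSU b c S' y * (windowSU b c S y * R y) := by
  rw [hlaw]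
  refine congrArg _ (funext fun y => ?_)
  rw [← mul_assoc, windowSU_mul_windowSU_of_le b c h y]

end Mono


end Summit.QuantumFields.YangMills.Theorems.N21WindowLetterAlgebra

end
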